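import Mathlib
import HarnessLib
import Summits.NavierStokesRegularity.NavierStokesRegularity.Theorems.PeepholeEchoDoorDefs

/-!
# PeepholeEchoDoorCore — S23 «PeepholeEchoDoor» (two-time peephole doors), part 2/4

§2 the generic two-time window limit: Fatou through the peephole along the tree velocity zoom (`twoTime_windowLimit`) and the analytic spread of a window identity to the slab (`hasTwoPointSymmetry_of_window`).

Door family of LADDER-NS N0 (local Type-I window doors S20/S21-C/S22/S23); THEOREMS-ONLY landing of the nsreg-p1 design
`run/shared/lean/pub/ns-regularity-ideate/ns-regularity-ideate-p1/r22/Sketch23.lean` (ROUND-22.md). Conditional door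
theorems: they EVADE hard core 10661 by hypothesis (T1/T2/T3/T5) or MEET it at the named wall (T4-D); no route, no items
(DIRECTOR-NS standing #32 (2)). WHAT THIS IS NOT: not a regularity claim; not an attack on `TypeIDSSLiouville`.
-/

noncomputable section

set_option linter.dupNamespace false

namespace Summit.NavierStokesRegularity.NavierStokesRegularity.Theorems.PeepholeEchoDoorCore

open MeasureTheory Set Function Filter Topology TopologicalSpace Metric
open scoped RealInnerProductSpace NNReal ENNReal Topology Pointwise
open Literature.Analysis Literature.Analysis.FluidPDE
open Summit.NavierStokesRegularity.NavierStokesRegularity.Theorems.LocalSineTubeDoorProfileAlignedWindowRigidityAncient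
open Summit.NavierStokesRegularity.NavierStokesRegularity.Theorems.PoloidalWindowDoorPoloidalWindowRigidityStrata
open Summit.NavierStokesRegularity.NavierStokesRegularity.Theorems.PoloidalWindowDoorPoloidalWindowRigidityFlat
open Summit.NavierStokesRegularity.NavierStokesRegularity.Theorems.PoloidalWindowDoorPoloidalWindowRigidityWindow
open Summit.NavierStokesRegularity.NavierStokesRegularity.Theorems.PeepholeEchoDoorDefs

/-! ## §2 The generic two-time window limit (Fatou through the peephole along a zoom) -/

section Core

variable {ν T : ℝ} {u : ℝ → EuclideanSpace ℝ (Fin 3) → EuclideanSpace ℝ (Fin 3)} {p : ℝ → EuclideanSpace ℝ (Fin 3) → ℝ}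
  {x₀ : EuclideanSpace ℝ (Fin 3)} {v : ℝ → EuclideanSpace ℝ (Fin 3) → EuclideanSpace ℝ (Fin 3)} {lam : ℕ → ℝ}

/-- **TWO-TIME WINDOW LIMIT.**  Along a velocity zoom `(λⱼ, v)` at `(x₀, T)` (rescaled velocities converge pointwise on
every slice, slices of `v` continuous), a faded `(κ, μ)`-defect on the open window `U` forces, for every `s < 0` and
`y ∈ U`, with `σ = √(−s)/√ν`:  `(σν) • v(s, σy) = (μσν) • v(κ s, (μσ) y)`. -/
theorem twoTime_windowLimit (hν : 0 < ν) (hT : 0 < T) (hcl : IsClassicalNSSolutionOn (Ico 0 T) ν 0 u p)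
    (hlam : ∀ j, 0 < lam j) (hlam0 : Tendsto lam atTop (𝓝 0))
    (hslice : ∀ s < 0, Continuous (v s))
    (hconv : ∀ s < 0, ∀ y,
      Tendsto (fun j => (lam j / ν) • u (T + lam j ^ 2 * s / ν) (x₀ + lam j • y)) atTop (𝓝 (v s y)))
    {κ μ : ℝ} (hκ : 0 < κ) (hμ : 0 < μ) {U : Set (EuclideanSpace ℝ (Fin 3))} (hU : IsOpen U)
    (hfade : DefectFades T x₀ u κ μ U) {s : ℝ} (hs : s < 0) {y : EuclideanSpace ℝ (Fin 3)} (hy : y ∈ U) :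
    (Real.sqrt (-s) / Real.sqrt ν * ν) • v s ((Real.sqrt (-s) / Real.sqrt ν) • y) =
      (μ * (Real.sqrt (-s) / Real.sqrt ν) * ν) • v (κ * s) ((μ * (Real.sqrt (-s) / Real.sqrt ν)) • y) := by
  -- ## zoom times `tⱼ = T + λⱼ² s/ν → T⁻` and their partners `t'ⱼ = T − κ(T − tⱼ) = T + λⱼ² (κs)/ν`
  have hns : 0 < -s := neg_pos.2 hs
  have hκs : κ * s < 0 := mul_neg_of_pos_of_neg hκ hs
  obtain ⟨t, ht⟩ : ∃ t : ℕ → ℝ, ∀ j, t j = T + lam j ^ 2 * s / ν := ⟨_, fun j => rfl⟩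
  have hTt : ∀ j, T - t j = lam j ^ 2 * (-s) / ν := fun j => by rw [ht j]; ring
  have ht' : ∀ j, T - κ * (T - t j) = T + lam j ^ 2 * (κ * s) / ν := fun j => by rw [ht j]; ring
  have hc : ∀ j, 0 < lam j ^ 2 * (-s) / ν := fun j => div_pos (mul_pos (pow_pos (hlam j) 2) hns) hν
  have hc0 : Tendsto (fun j => lam j ^ 2 * (-s) / ν) atTop (𝓝 0) := by
    simpa using ((hlam0.pow 2).mul_const (-s)).div_const ν
  have htT : Tendsto t atTop (𝓝[<] T) := by
    refine tendsto_nhdsWithin_iff.2 ⟨?_, Eventually.of_forall fun j => ?_⟩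
    · have h1 : Tendsto (fun j => T - lam j ^ 2 * (-s) / ν) atTop (𝓝 (T - 0)) :=
        tendsto_const_nhds.sub hc0
      rw [sub_zero] at h1
      refine h1.congr fun j => ?_
      rw [ht j]; ring
    · show t j < T
      have h1 := hc j
      rw [← hTt j] at h1
      linarith
  have htT' : Tendsto (fun j => T - κ * (T - t j)) atTop (𝓝[<] T) := by
    refine tendsto_nhdsWithin_iff.2 ⟨?_, Eventually.of_forall fun j => ?_⟩
    · have h1 : Tendsto (fun j => T - κ * (lam j ^ 2 * (-s) / ν)) atTop (𝓝 (T - κ * 0)) :=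
        tendsto_const_nhds.sub (hc0.const_mul κ)
      rw [mul_zero, sub_zero] at h1
      refine h1.congr fun j => ?_
      rw [hTt j]
    · show T - κ * (T - t j) < T
      have h1 := mul_pos hκ (hc j)
      rw [← hTt j] at h1
      linarith
  have hev : ∀ᶠ j in atTop, t j ∈ Set.Ioo 0 T ∧ T - κ * (T - t j) ∈ Set.Ioo 0 T :=
    (htT.eventually (Ioo_mem_nhdsLT hT)).and (htT'.eventually (Ioo_mem_nhdsLT hT))
  obtain ⟨j₀, hj₀⟩ := eventually_atTop.1 hev
  have hshift : Tendsto (fun j : ℕ => j + j₀) atTop atTop := tendsto_add_atTop_nat j₀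
  have hfadej : Tendsto (fun j => ∫⁻ y in U, ENNReal.ofReal (twoTimeDefect T x₀ u κ μ (t (j + j₀)) y))
      atTop (𝓝 0) := (hfade.comp htT).comp hshift
  -- ## the similarity scale along the zoom: `√(T − tⱼ) = λⱼ σ`, `σ = √(−s)/√ν`
  set σ : ℝ := Real.sqrt (-s) / Real.sqrt ν with hσ
  have hσpos : 0 < σ := div_pos (Real.sqrt_pos.2 hns) (Real.sqrt_pos.2 hν)
  have hsq : ∀ j, Real.sqrt (T - t j) = lam j * σ := by
    intro j
    rw [hTt j, hσ, Real.sqrt_div' _ hν.le, Real.sqrt_mul (pow_nonneg (hlam j).le 2),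
      Real.sqrt_sq (hlam j).le]
    ring
  -- the two window fields at time `tⱼ` versus the rescaled velocities at `σ y` and `(μσ) y`
  set W : ℕ → EuclideanSpace ℝ (Fin 3) → EuclideanSpace ℝ (Fin 3) := fun j y =>
    Real.sqrt (T - t (j + j₀)) • u (t (j + j₀)) (x₀ + Real.sqrt (T - t (j + j₀)) • y) with hWdef
  have hW : ∀ (j : ℕ) (y : EuclideanSpace ℝ (Fin 3)), W j y =
      (σ * ν) • ((lam (j + j₀) / ν) • u (T + lam (j + j₀) ^ 2 * s / ν)
        (x₀ + lam (j + j₀) • (σ • y))) := by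
    intro j y
    simp only [hWdef, hsq (j + j₀), smul_smul]
    rw [ht (j + j₀)]
    congr 1
    field_simp
  set W' : ℕ → EuclideanSpace ℝ (Fin 3) → EuclideanSpace ℝ (Fin 3) := fun j y =>
    (μ * Real.sqrt (T - t (j + j₀))) • u (T - κ * (T - t (j + j₀)))
      (x₀ + (μ * Real.sqrt (T - t (j + j₀))) • y) with hW'def
  have hW' : ∀ (j : ℕ) (y : EuclideanSpace ℝ (Fin 3)), W' j y =
      (μ * σ * ν) • ((lam (j + j₀) / ν) • u (T + lam (j + j₀) ^ 2 * (κ * s) / ν)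
        (x₀ + lam (j + j₀) • ((μ * σ) • y))) := by
    intro j y
    simp only [hW'def, hsq (j + j₀), smul_smul]
    rw [ht' (j + j₀)]
    congr 1
    · field_simp
    · congr 2
      ring
  -- ## the limit defect in window coordinates and its continuity
  set Hs : EuclideanSpace ℝ (Fin 3) → ℝ := fun y =>
    ‖(σ * ν) • v s (σ • y) - (μ * σ * ν) • v (κ * s) ((μ * σ) • y)‖ with hHsdef
  have hvs : Continuous (v s) := hslice s hs
  have hvs' : Continuous (v (κ * s)) := hslice (κ * s) hκs
  have hHscont : Continuous Hs := by
    show Continuous fun y => ‖(σ * ν) • v s (σ • y) - (μ * σ * ν) • v (κ * s) ((μ * σ) • y)‖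
    exact (((hvs.comp (continuous_const_smul σ)).const_smul (σ * ν)).sub
      ((hvs'.comp (continuous_const_smul (μ * σ))).const_smul (μ * σ * ν))).norm
  have hconvW : ∀ y, Tendsto (fun j => W j y) atTop (𝓝 ((σ * ν) • v s (σ • y))) := by
    intro y
    have h := ((hconv s hs (σ • y)).comp hshift).const_smul (σ * ν)
    exact h.congr fun j => (hW j y).symm
  have hconvW' : ∀ y, Tendsto (fun j => W' j y) atTop (𝓝 ((μ * σ * ν) • v (κ * s) ((μ * σ) • y))) := by
    intro y
    have h := ((hconv (κ * s) hκs ((μ * σ) • y)).comp hshift).const_smul (μ * σ * ν)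
    exact h.congr fun j => (hW' j y).symm
  have hconvH : ∀ y, Tendsto (fun j => ‖W j y - W' j y‖) atTop (𝓝 (Hs y)) := fun y =>
    ((hconvW y).sub (hconvW' y)).norm
  -- measurability of the window fields: `u(tⱼ)`, `u(t'ⱼ)` are smooth for the shifted times
  have hmem : ∀ j, t (j + j₀) ∈ Set.Ico 0 T := fun j =>
    ⟨((hj₀ (j + j₀) (Nat.le_add_left _ _)).1).1.le, ((hj₀ (j + j₀) (Nat.le_add_left _ _)).1).2⟩
  have hmem' : ∀ j, T - κ * (T - t (j + j₀)) ∈ Set.Ico 0 T := fun j =>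
    ⟨((hj₀ (j + j₀) (Nat.le_add_left _ _)).2).1.le, ((hj₀ (j + j₀) (Nat.le_add_left _ _)).2).2⟩
  have hφ : ∀ c : ℝ, Continuous fun y : EuclideanSpace ℝ (Fin 3) => x₀ + c • y :=
    fun c => continuous_const.add (continuous_const_smul _)
  have hWc : ∀ j, Continuous (W j) := fun j => by
    show Continuous fun y => Real.sqrt (T - t (j + j₀)) • u (t (j + j₀)) (x₀ + Real.sqrt (T - t (j + j₀)) • y)
    exact ((hcl.contDiff_velocity (hmem j)).continuous.comp (hφ _)).const_smul (Real.sqrt (T - t (j + j₀)))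
  have hW'c : ∀ j, Continuous (W' j) := fun j => by
    show Continuous fun y => (μ * Real.sqrt (T - t (j + j₀))) • u (T - κ * (T - t (j + j₀)))
      (x₀ + (μ * Real.sqrt (T - t (j + j₀))) • y)
    exact ((hcl.contDiff_velocity (hmem' j)).continuous.comp (hφ _)).const_smul (μ * Real.sqrt (T - t (j + j₀)))
  have hFjc : ∀ j, Continuous fun y => ‖W j y - W' j y‖ := fun j => ((hWc j).sub (hW'c j)).norm
  have hdefect : ∀ j y, twoTimeDefect T x₀ u κ μ (t (j + j₀)) y = ‖W j y - W' j y‖ := fun j y => rfl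
  -- ## FATOU: the faded defect vanishes on the window in the limit
  set g : EuclideanSpace ℝ (Fin 3) → ℝ≥0∞ := fun y => ENNReal.ofReal (Hs y) with hg
  have hgc : Continuous g := ENNReal.continuous_ofReal.comp hHscont
  have hgjm : ∀ j, Measurable fun y => ENNReal.ofReal ‖W j y - W' j y‖ :=
    fun j => (ENNReal.continuous_ofReal.comp (hFjc j)).measurable
  have hptw : ∀ y, Tendsto (fun j => ENNReal.ofReal ‖W j y - W' j y‖) atTop (𝓝 (g y)) :=
    fun y => ENNReal.tendsto_ofReal (hconvH y)
  have hFatou : ∫⁻ y in U, liminf (fun j => ENNReal.ofReal ‖W j y - W' j y‖) atTop ≤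
      liminf (fun j => ∫⁻ y in U, ENNReal.ofReal ‖W j y - W' j y‖) atTop :=
    lintegral_liminf_le' (fun j => (hgjm j).aemeasurable)
  have hlim : (fun y => liminf (fun j => ENNReal.ofReal ‖W j y - W' j y‖) atTop) = g :=
    funext fun y => (hptw y).liminf_eq
  have hfadeW : Tendsto (fun j => ∫⁻ y in U, ENNReal.ofReal ‖W j y - W' j y‖) atTop (𝓝 0) := by
    refine hfadej.congr fun j => ?_
    simp only [hdefect]
  rw [hlim, hfadeW.liminf_eq] at hFatou
  have hint : ∫⁻ y in U, g y = 0 := le_antisymm hFatou bot_le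
  have hae : ∀ᵐ y ∂(volume.restrict U), g y = 0 := (lintegral_eq_zero_iff hgc.measurable).1 hint
  rw [ae_restrict_iff' hU.measurableSet] at hae
  have hzero : ∀ y ∈ U, g y = 0 := by
    intro y hy
    by_contra hne
    set O : Set (EuclideanSpace ℝ (Fin 3)) := U ∩ g ⁻¹' (Ioi 0) with hO
    have hOo : IsOpen O := hU.inter (isOpen_Ioi.preimage hgc)
    have hO0 : volume O = 0 := by
      rw [measure_eq_zero_iff_ae_notMem]
      filter_upwards [hae] with y' hy'
      rintro ⟨h1, h2⟩
      have := hy' h1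
      simp only [mem_preimage, mem_Ioi, this, lt_self_iff_false] at h2
    have hOe : O = ∅ := (hOo.measure_eq_zero_iff volume).1 hO0
    have hyO : y ∈ O := ⟨hy, by simpa [mem_preimage, mem_Ioi, pos_iff_ne_zero] using hne⟩
    rw [hOe] at hyO
    exact hyO
  have h := hzero y hy
  simp only [hg, ENNReal.ofReal_eq_zero] at h
  have h0 : Hs y = 0 := le_antisymm h (norm_nonneg _)
  have h1 : (σ * ν) • v s (σ • y) - (μ * σ * ν) • v (κ * s) ((μ * σ) • y) = 0 := norm_eq_zero.1 h0
  exact sub_eq_zero.1 h1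

/-- **SPREADING by slice analyticity.**  In the door class, the window identity of `twoTime_windowLimit` on an open
nonempty `U` for every `s < 0` upgrades to the two-point symmetry `v(s, z) = μ · v(κ s, μ z)` on the whole slab. -/
theorem hasTwoPointSymmetry_of_window {C : ℝ} (hrate : HasTypeITimeDecay C v)
    (hcont : ContinuousOn (uncurry v) (Iio (0 : ℝ) ×ˢ univ))
    (hmild : ∀ s t : ℝ, s < t → t < 0 → ∀ x,
      v t x = UnboundedOperators.heatExtension (v s) (t - s) x - oseenDuhamel 1 s v v t x)
    (hν : 0 < ν) {κ μ : ℝ} (hκ : 0 < κ) (_hμ : 0 < μ) {U : Set (EuclideanSpace ℝ (Fin 3))} (hU : IsOpen U)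
    (hUne : U.Nonempty)
    (hwin : ∀ s < 0, ∀ y ∈ U, (Real.sqrt (-s) / Real.sqrt ν * ν) • v s ((Real.sqrt (-s) / Real.sqrt ν) • y) =
      (μ * (Real.sqrt (-s) / Real.sqrt ν) * ν) • v (κ * s) ((μ * (Real.sqrt (-s) / Real.sqrt ν)) • y)) :
    HasTwoPointSymmetry κ μ v := by
  intro s hs z
  have hns : 0 < -s := neg_pos.2 hs
  have hκs : κ * s < 0 := mul_neg_of_pos_of_neg hκ hs
  set σ : ℝ := Real.sqrt (-s) / Real.sqrt ν with hσ
  have hσpos : 0 < σ := div_pos (Real.sqrt_pos.2 hns) (Real.sqrt_pos.2 hν)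
  have hσν : σ * ν ≠ 0 := mul_ne_zero hσpos.ne' hν.ne'
  -- the identity on the open window `σ • U`
  have hwin' : ∀ w ∈ σ • U, v s w = μ • v (κ * s) (μ • w) := by
    rintro w ⟨y, hy, rfl⟩
    have h := hwin s hs y hy
    have h2 : (μ * σ * ν) • v (κ * s) ((μ * σ) • y) = (σ * ν) • (μ • v (κ * s) (μ • (σ • y))) := by
      rw [smul_smul, smul_smul, show σ * ν * μ = μ * σ * ν by ring]
    rw [h2] at h
    exact smul_right_injective _ hσν h
  -- both sides are real-analytic slices
  have hbdd := bdd_of_hasTypeITimeDecay hrate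
  have han1 : AnalyticOnNhd ℝ (v s) univ := analyticOnNhd_slice hcont hbdd hmild hs
  have han2 : AnalyticOnNhd ℝ (v (κ * s)) univ := analyticOnNhd_slice hcont hbdd hmild hκs
  have hanL : AnalyticOnNhd ℝ (fun w : EuclideanSpace ℝ (Fin 3) => μ • w) univ := fun w _ =>
    (analyticAt_id.const_smul (c := μ))
  have han3 : AnalyticOnNhd ℝ (fun w => μ • v (κ * s) (μ • w)) univ := by
    have hcomp : AnalyticOnNhd ℝ (v (κ * s) ∘ fun w : EuclideanSpace ℝ (Fin 3) => μ • w) univ :=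
      han2.comp hanL (fun _ _ => mem_univ _)
    exact fun w hw => (hcomp w hw).const_smul (c := μ)
  set f : EuclideanSpace ℝ (Fin 3) → EuclideanSpace ℝ (Fin 3) := fun w => v s w - μ • v (κ * s) (μ • w) with hf
  have hfan : AnalyticOnNhd ℝ f univ := han1.sub han3
  -- `f` vanishes on the open nonempty set `σ • U`, hence everywhere (identity theorem on the connected `ℝ³`)
  obtain ⟨y₀, hy₀⟩ := hUne
  have hOpen : IsOpen (σ • U) := hU.smul₀ hσpos.ne'
  have hmem0 : σ • y₀ ∈ σ • U := smul_mem_smul_set hy₀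
  have hfz : f =ᶠ[𝓝 (σ • y₀)] 0 := by
    filter_upwards [hOpen.mem_nhds hmem0] with w hw
    simp only [hf, Pi.zero_apply, sub_eq_zero]
    exact hwin' w hw
  have hEq : EqOn f 0 univ :=
    hfan.eqOn_zero_of_preconnected_of_eventuallyEq_zero isPreconnected_univ (mem_univ _) hfz
  have := hEq (mem_univ z)
  simp only [hf, Pi.zero_apply, sub_eq_zero] at this
  exact this

end Core


end Summit.NavierStokesRegularity.NavierStokesRegularity.Theorems.PeepholeEchoDoorCore

end
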